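import Mathlib
import Summits.ValiantsHypothesis.ValiantsHypothesis.Theorems.RigidityForcesSymmetryRankRigidMinimalReprLaplaceFiveSeparatedCaptureDefs

/-!
# ValiantsHypothesis / RigidityForcesSymmetry — crux `LaplaceOptimalFive` (stmt-ValiantsHypothesis-24813), separated / symmetric capture:
# **TWO-TERM LEMMAS** (letter-tensor bricks for the `Ω ≠ 0` part of `CaptureIneqSym`)

Memo `pub/val-lit/lmr/NOTE-p4g17-24813-K32-symmetric-capture.md` §9–§10.  In the symmetric capture problem every captured obligation
`T_μ = contractZ μ` is a symmetric 3-tensor vanishing at words with a repeated letter, written as `u₁ ⊗ a` on the slots `01|2` plus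
`u₂ ⊗ b` on `02|1` plus `u₃ ⊗ c` on `12|0` (one-dimensional spans) or sums of such; comparing two slot orders shows that the DIFFERENCES
`u ⊗ a − u′ ⊗ b` are fully symmetric.  This file proves the letter-tensor facts that drive the case analysis:

* `contractZ_swap12`, `contractZ_swap23`, `contractZ_rep12` — the obligation tensor is symmetric and vanishes on a repeated letter
  (companions of ✓ `perm5_swap`, ✓ `perm5_rep`).
* `rankOne_of_tensor_symm` — if `M ⊗ a` (M symmetric) is symmetric in its last two slots and `a r₀ ≠ 0`, then `M = κ·a aᵀ`.
* `twoTerm_parallel` — if all `2 × 2` minors of `(a, b)` vanish and `a r₀ ≠ 0`, then `b = (b r₀ / a r₀) • a`.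
* ★ `twoTerm_binary` — THE TWO-TERM SYMMETRIC LEMMA: if `u ⊗ a − u′ ⊗ b` is symmetric in its last two slots and some minor
  `a r₁ b r₂ − a r₂ b r₁ ≠ 0`, then `u y = u′ y = 0` for every `y ⊥ a, b` — both quadrics are BINARY forms in `⟨a, b⟩`
  (the tensor form of «`dq∧dℓ = dq′∧dℓ′` with `ℓ ∦ ℓ′` forces `q, q′ ∈ ℂ[ℓ, ℓ′]`»; proof: contract the identity with `y` in the middle slot).
* `symm_killing_hyperplane` — a symmetric `u` with `a r₀ · u p q = a q · u p r₀` is `κ·a aᵀ`.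

Honest framing.  Bricks only; `CaptureIneqSym`, K1 on `K₃ ⊔ K₂`, S2′, `LaplaceOptimalFive` (OPEN · CONTESTED 72/120), `VP ≠ VNP` are NOT proved.
No definitions, no `sorry`; Mathlib + tree only.
-/

set_option linter.dupNamespace false
set_option autoImplicit false

namespace Summit.ValiantsHypothesis.ValiantsHypothesis.Theorems.RigidityForcesSymmetryRankRigidMinimalRepr

namespace LaplaceFiveSeparatedCapture

open Finset LaplaceFiveSectorSplit

/-! ### Symmetries of the obligation tensor -/

/-- Swapping the first two triangle letters is precomposition with `(0 1)`. [folklore] -/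
lemma word_swap01 (p q r s t : Fin 5) : word q p r s t = word p q r s t ∘ Equiv.swap (0 : Fin 5) 1 := by
  funext i
  fin_cases i <;> simp [word, Equiv.swap_apply_of_ne_of_ne]

/-- Swapping the last two triangle letters is precomposition with `(1 2)`. [folklore] -/
lemma word_swap12 (p q r s t : Fin 5) : word p r q s t = word p q r s t ∘ Equiv.swap (1 : Fin 5) 2 := by
  funext i
  fin_cases i <;> simp [word, Equiv.swap_apply_of_ne_of_ne]

/-- `P₅` is invariant under precomposition with a slot permutation. [folklore] -/
lemma perm5_comp_perm (v : Fin 5 → Fin 5) (σ : Equiv.Perm (Fin 5)) : perm5 (v ∘ ⇑σ) = perm5 v := by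
  unfold perm5
  by_cases h : Function.Injective v
  · rw [if_pos h, if_pos (h.comp σ.injective)]
  · rw [if_neg h, if_neg]
    intro h'
    apply h
    have := h'.comp σ.symm.injective
    simpa [Function.comp_assoc] using this

/-- The obligation tensor is symmetric in its first two slots. [folklore] -/
theorem contractZ_swap12 (μ : Fin 5 → Fin 5 → ℂ) (p q r : Fin 5) : contractZ μ q p r = contractZ μ p q r := by
  unfold contractZ
  refine Finset.sum_congr rfl fun s _ => Finset.sum_congr rfl fun t _ => ?_
  rw [word_swap01, perm5_comp_perm]

/-- The obligation tensor is symmetric in its last two slots. [folklore] -/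
theorem contractZ_swap23 (μ : Fin 5 → Fin 5 → ℂ) (p q r : Fin 5) : contractZ μ p r q = contractZ μ p q r := by
  unfold contractZ
  refine Finset.sum_congr rfl fun s _ => Finset.sum_congr rfl fun t _ => ?_
  rw [word_swap12, perm5_comp_perm]

/-- The obligation tensor vanishes when the first two letters coincide. [folklore] -/
theorem contractZ_rep12 (μ : Fin 5 → Fin 5 → ℂ) (p r : Fin 5) : contractZ μ p p r = 0 := by
  unfold contractZ
  refine Finset.sum_eq_zero fun s _ => Finset.sum_eq_zero fun t _ => ?_
  have h : perm5 (word p p r s t) = 0 := by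
    unfold perm5
    rw [if_neg]
    intro hinj
    have := @hinj 0 1 (by simp [word])
    exact absurd this (by decide)
  rw [h, mul_zero]

/-! ### Rank-one and two-term lemmas -/

/-- RANK-ONE LEMMA: a symmetric `M` with `M ⊗ a` symmetric in its last two slots and `a r₀ ≠ 0` is a multiple of `a aᵀ`:
`M p q = (M r₀ r₀ / a r₀ ^ 2) · a p · a q`. [folklore] -/
theorem rankOne_of_tensor_symm (M : Fin 5 → Fin 5 → ℂ) (a : Fin 5 → ℂ) (hM : ∀ p q, M p q = M q p)
    (h : ∀ p q r, M p q * a r = M p r * a q) (r₀ : Fin 5) (ha : a r₀ ≠ 0) (p q : Fin 5) :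
    M p q = M r₀ r₀ / a r₀ ^ 2 * a p * a q := by
  have h1 : M p q * a r₀ = M p r₀ * a q := h p q r₀
  have h2 : M r₀ p * a r₀ = M r₀ r₀ * a p := h r₀ p r₀
  rw [hM r₀ p] at h2
  have h3 : M p q * a r₀ ^ 2 = M r₀ r₀ * a p * a q := by
    calc M p q * a r₀ ^ 2 = (M p q * a r₀) * a r₀ := by ring
      _ = M p r₀ * a r₀ * a q := by rw [h1]; ring
      _ = M r₀ r₀ * a p * a q := by rw [h2]
  field_simp
  linear_combination h3

/-- PARALLEL BRANCH: if every `2 × 2` minor of `(a, b)` vanishes and `a r₀ ≠ 0` then `b = (b r₀ / a r₀) • a`. [folklore] -/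
theorem twoTerm_parallel (a b : Fin 5 → ℂ) (hmin : ∀ r₁ r₂, a r₁ * b r₂ = a r₂ * b r₁) (r₀ : Fin 5) (ha : a r₀ ≠ 0) :
    b = (b r₀ / a r₀) • a := by
  funext r
  simp only [Pi.smul_apply, smul_eq_mul]
  have := hmin r₀ r
  field_simp
  linear_combination this

/-- ★ TWO-TERM SYMMETRIC LEMMA (binary branch).  If `u ⊗ a − u′ ⊗ b` is symmetric in its last two slots and the minor
`a r₁ b r₂ − a r₂ b r₁` is non-zero, then `u` and `u′` both annihilate every `y` with `a·y = b·y = 0` (they are binary quadrics in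
`⟨a, b⟩`).  Proof: contracting the identity with `y` in the middle slot gives `(u y)_p · a r − (u′ y)_p · b r = 0` for all `r`. [folklore] -/
theorem twoTerm_binary (u u' : Fin 5 → Fin 5 → ℂ) (a b : Fin 5 → ℂ)
    (hS : ∀ p q r, u p q * a r - u' p q * b r = u p r * a q - u' p r * b q)
    (r₁ r₂ : Fin 5) (hmin : a r₁ * b r₂ - a r₂ * b r₁ ≠ 0)
    (y : Fin 5 → ℂ) (hya : ∑ i, a i * y i = 0) (hyb : ∑ i, b i * y i = 0) (p : Fin 5) :
    (∑ q, u p q * y q) = 0 ∧ (∑ q, u' p q * y q) = 0 := by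
  have key : ∀ r, (∑ q, u p q * y q) * a r - (∑ q, u' p q * y q) * b r = 0 := by
    intro r
    have h1 : ∑ q, (u p q * a r - u' p q * b r) * y q = ∑ q, (u p r * a q - u' p r * b q) * y q :=
      Finset.sum_congr rfl fun q _ => by rw [hS p q r]
    have h2 : ∑ q, (u p r * a q - u' p r * b q) * y q = u p r * ∑ i, a i * y i - u' p r * ∑ i, b i * y i := by
      rw [Finset.mul_sum, Finset.mul_sum, ← Finset.sum_sub_distrib]
      exact Finset.sum_congr rfl fun q _ => by ring
    rw [h2, hya, hyb, mul_zero, mul_zero, sub_zero] at h1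
    rw [← h1, Finset.sum_mul, Finset.sum_mul, ← Finset.sum_sub_distrib]
    exact Finset.sum_congr rfl fun q _ => by ring
  set X := ∑ q, u p q * y q with hX
  set Y := ∑ q, u' p q * y q with hY
  have k1 := key r₁
  have k2 := key r₂
  have hX0 : X * (a r₁ * b r₂ - a r₂ * b r₁) = 0 := by linear_combination b r₂ * k1 - b r₁ * k2
  have hX : X = 0 := by
    rcases mul_eq_zero.mp hX0 with h | h
    · exact h
    · exact absurd h hmin
  have hY0 : Y * (a r₁ * b r₂ - a r₂ * b r₁) = 0 := by linear_combination a r₂ * k1 - a r₁ * k2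
  have hY : Y = 0 := by
    rcases mul_eq_zero.mp hY0 with h | h
    · exact h
    · exact absurd h hmin
  exact ⟨hX, hY⟩

/-- A symmetric matrix whose columns satisfy `a r₀ · u p q = a q · u p r₀` (i.e. `u` kills the hyperplane `a^⊥` through the
test vectors `a r₀ e_q − a q e_{r₀}`) is `κ·a aᵀ` with `κ = u r₀ r₀ / a r₀ ^ 2`. [folklore] -/
theorem symm_killing_hyperplane (u : Fin 5 → Fin 5 → ℂ) (a : Fin 5 → ℂ) (hu : ∀ p q, u p q = u q p) (r₀ : Fin 5)
    (ha : a r₀ ≠ 0) (h : ∀ p q, a r₀ * u p q = a q * u p r₀) (p q : Fin 5) :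
    u p q = u r₀ r₀ / a r₀ ^ 2 * a p * a q := by
  have h1 := h p q
  have h2 := h r₀ p
  rw [hu r₀ p] at h2
  have h3 : u p q * a r₀ ^ 2 = u r₀ r₀ * a p * a q := by
    calc u p q * a r₀ ^ 2 = (a r₀ * u p q) * a r₀ := by ring
      _ = a q * u p r₀ * a r₀ := by rw [h1]
      _ = a q * (a r₀ * u p r₀) := by ring
      _ = a q * (a p * u r₀ r₀) := by rw [h2]
      _ = u r₀ r₀ * a p * a q := by ring
  field_simp
  linear_combination h3

/-- THREE CUBES: if `κ₁ a⊗a⊗a + κ₂ b⊗b⊗b + κ₃ c⊗c⊗c` vanishes at every word `(p, p, r)` and the `3 × 3` minor of `(a, b, c)` on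
rows `r₁, r₂, r₃` is non-zero, then `κ₁ a p ^ 2 = κ₂ b p ^ 2 = κ₃ c p ^ 2 = 0` for every `p`. [folklore] -/
theorem three_cubes (κ₁ κ₂ κ₃ : ℂ) (a b c : Fin 5 → ℂ)
    (h : ∀ p r, κ₁ * a p ^ 2 * a r + κ₂ * b p ^ 2 * b r + κ₃ * c p ^ 2 * c r = 0)
    (r₁ r₂ r₃ : Fin 5)
    (hdet : a r₁ * (b r₂ * c r₃ - b r₃ * c r₂) - b r₁ * (a r₂ * c r₃ - a r₃ * c r₂)
      + c r₁ * (a r₂ * b r₃ - a r₃ * b r₂) ≠ 0) (p : Fin 5) :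
    κ₁ * a p ^ 2 = 0 ∧ κ₂ * b p ^ 2 = 0 ∧ κ₃ * c p ^ 2 = 0 := by
  have h1 := h p r₁
  have h2 := h p r₂
  have h3 := h p r₃
  set D := a r₁ * (b r₂ * c r₃ - b r₃ * c r₂) - b r₁ * (a r₂ * c r₃ - a r₃ * c r₂)
      + c r₁ * (a r₂ * b r₃ - a r₃ * b r₂) with hD
  have e1 : κ₁ * a p ^ 2 * D = 0 := by
    linear_combination (b r₂ * c r₃ - b r₃ * c r₂) * h1 + (b r₃ * c r₁ - b r₁ * c r₃) * h2
      + (b r₁ * c r₂ - b r₂ * c r₁) * h3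
  have e2 : κ₂ * b p ^ 2 * D = 0 := by
    linear_combination (a r₃ * c r₂ - a r₂ * c r₃) * h1 + (a r₁ * c r₃ - a r₃ * c r₁) * h2
      + (a r₂ * c r₁ - a r₁ * c r₂) * h3
  have e3 : κ₃ * c p ^ 2 * D = 0 := by
    linear_combination (a r₂ * b r₃ - a r₃ * b r₂) * h1 + (a r₃ * b r₁ - a r₁ * b r₃) * h2
      + (a r₁ * b r₂ - a r₂ * b r₁) * h3
  refine ⟨?_, ?_, ?_⟩
  · rcases mul_eq_zero.mp e1 with h | h
    · exact h
    · exact absurd h hdet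
  · rcases mul_eq_zero.mp e2 with h | h
    · exact h
    · exact absurd h hdet
  · rcases mul_eq_zero.mp e3 with h | h
    · exact h
    · exact absurd h hdet

end LaplaceFiveSeparatedCapture

end Summit.ValiantsHypothesis.ValiantsHypothesis.Theorems.RigidityForcesSymmetryRankRigidMinimalRepr
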